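import Summits.ValiantsHypothesis.ValiantsHypothesis.Theorems.LacunarySymmetroidMatrixDescartesCensusFlankRow
import Literature.Analysis.FluidPDE.ElgindiRadialCoefficients

/-!
# `MatrixDescartes` census — W4: the TWO-ROW COVARIANCE KILL of the elbow-6 edge `ZP(6..17)` in the kernel, chamber-uniform

HONEST FRAMING.  Object-search cell `pub-symmetroid`, item `DoorA26 = PosRootLawAt 2 6 19` (stmt-ValiantsHypothesis-19979,
OPEN, typed, never asserted).  The W4 line (engine-1 g17–g20: notes TROPFAN-W4-E1G17, CAPACITY09-E1G18, TWOROW-E1G19, W4-E1G20)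
studies the DEGENERATIONS of HYPOTHETICAL Descartes-sharp symmetric `2 × 2` six-term pencils on a support of chamber 1706
(pair-sum order of `(0,2,3,7,16,27)`: `d₁ < d₂ < 2d₁`, `2d₂ < d₃`, `2d₃ < d₄`, `2d₄ − d₃ < d₅ < 2d₄ − d₂`).  A degeneration
«through elbow 6» would need the hull-edge form of the long edge `6..17` (EDGE GRAM LEMMA, zero-pattern pencil)
`F = (a₀ + a₁X^{d₁} + a₂X^{d₂})(c₃X^{d₃} + c₄X^{d₄} + c₅X^{d₅}) − (b₃X^{d₃} + b₄X^{d₄})²`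
(12 terms) to have `11 = #terms − 1` positive roots COUNTED WITH MULTIPLICITY, with the cell's signs `a₀c₃, a₀c₄ > 0 > a₁c₃, a₁c₄`.
This file proves, for EVERY exponent vector of the chamber (the upper facet `d₅ < 2d₄ − d₂` is not even used) and every
such coefficient vector, `#Z₊^{mult}(F) ≤ 9`: the channel is dead, support-free (seat note TWOROW-E1G19 §2 proved it support
by support on the 115 core supports of the box; W4-E1G20 §2 «THEOREM O6» is this file).  Proof = the seat's two-row
covariance kill: eight Euler twists (the tree's `countP_posRoots_le_countP_twists`) kill every term except the rows
`a₀, a₁` against the columns `c₃, c₄`; the residual tetranomial `X^{d₃}(α + βX^g − γX^{d₁} − ηX^{g+d₁})` has AT MOST ONE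
positive root, simple, as soon as `βγ ≤ αη` (`countP_posRoots_tetranomial_le_one`: the ratio `(α+βu)/(γ+ηu)` is
non-increasing), and `βγ ≤ αη` is the chamber-uniform multiplier inequality `|M₀₄|·|M₁₃| ≤ |M₀₃|·|M₁₄|`
(`twoRow_multiplier_ineq_6_17`, a product inequality between linear forms in `d`, certified by three grouped
sub-inequalities with non-negative slack expansions).  Mirror statement (elbow 14 on chamber 954) by `d ↦ −d` bookkeeping,
not typed here.  Nothing in this file bounds `ζ_sym(2,6)`, decides `DoorA26`, or bears on the crux `MatrixDescartes`
(stmt-ValiantsHypothesis-18050) / `VP ≠ VNP`: a dead channel is a statement about hypothetical objects.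

[folklore] Rolle with multiplicity (Euler twists) + an elementary monotonicity argument; no single source.
(The import of `Literature.Analysis.FluidPDE.ElgindiRadialCoefficients` only reuses its monomial identity
`X · (X^a)′ = a · X^a`, as the tree's dedup rule requires.)
-/

-- `Summit.ValiantsHypothesis.ValiantsHypothesis.…` repeats a component by the D-0017 layout
-- (single-conjunct summit), which the `dupNamespace` linter flags; the name is mandated.
set_option linter.dupNamespace false

namespace Summit.ValiantsHypothesis.ValiantsHypothesis.Theorems.LacunarySymmetroidMatrixDescartes.Census

open Polynomial Finset
open scoped BigOperators Polynomial

/-! ### The residual tetranomial of a two-row kill has at most one positive root, counted with multiplicity -/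

/-- No two positive roots: if `α, β, γ, η > 0`, `βγ ≤ αη` and `δ ≥ 1`, the equation
`α + β u^g = u^δ (γ + η u^g)` has at most one positive solution (the left/right ratio is non-increasing in `u`,
`u^δ` is strictly increasing). [folklore] -/
theorem tetranomial_no_two_posRoots {α β γ η : ℝ} (hγ : 0 < γ) (hη : 0 < η)
    (hmono : β * γ ≤ α * η) {g δ : ℕ} (hδ : 0 < δ) {x y : ℝ} (hx : 0 < x) (hxy : x < y)
    (hrx : α + β * x ^ g - γ * x ^ δ - η * x ^ (g + δ) = 0)
    (hry : α + β * y ^ g - γ * y ^ δ - η * y ^ (g + δ) = 0) : False := by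
  have hy : 0 < y := hx.trans hxy
  have hug : x ^ g ≤ y ^ g := pow_le_pow_left₀ hx.le hxy.le g
  have hud : x ^ δ < y ^ δ := pow_lt_pow_left₀ hxy hx.le hδ.ne'
  have hpx : 0 < γ + η * x ^ g := by positivity
  have hpy : 0 < γ + η * y ^ g := by positivity
  -- root equations in product form
  have ex : α + β * x ^ g = x ^ δ * (γ + η * x ^ g) := by rw [pow_add] at hrx; linarith
  have ey : α + β * y ^ g = y ^ δ * (γ + η * y ^ g) := by rw [pow_add] at hry; linarith
  -- monotonicity of the ratio: (α+βx^g)(γ+ηy^g) ≥ (α+βy^g)(γ+ηx^g)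
  have key : (α + β * y ^ g) * (γ + η * x ^ g) ≤ (α + β * x ^ g) * (γ + η * y ^ g) := by
    nlinarith [mul_nonneg (sub_nonneg.2 hmono) (sub_nonneg.2 hug)]
  rw [ex, ey] at key
  -- key : y^δ (γ+ηy^g)(γ+ηx^g) ≤ x^δ (γ+ηx^g)(γ+ηy^g)
  have : (y ^ δ - x ^ δ) * ((γ + η * x ^ g) * (γ + η * y ^ g)) ≤ 0 := by nlinarith [key]
  have hprod : 0 < (γ + η * x ^ g) * (γ + η * y ^ g) := mul_pos hpx hpy
  nlinarith [mul_pos (sub_pos.2 hud) hprod]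

/-- Simple roots: at a positive root `u` of `α + βX^g − γX^δ − ηX^{g+δ}` (`β, γ, η > 0`, `βγ ≤ αη`, `δ ≥ 1`) the
Euler derivative `βg u^g − γδ u^δ − η(g+δ) u^{g+δ}` is non-zero (it is `< 0`). [folklore] -/
theorem tetranomial_euler_ne_zero {α β γ η : ℝ} (hγ : 0 < γ) (hη : 0 < η)
    (hmono : β * γ ≤ α * η) {g δ : ℕ} (hδ : 0 < δ) {x : ℝ} (hx : 0 < x)
    (hrx : α + β * x ^ g - γ * x ^ δ - η * x ^ (g + δ) = 0)
    (hD : β * g * x ^ g - γ * δ * x ^ δ - η * (g + δ) * x ^ (g + δ) = 0) : False := by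
  have hδ' : (1 : ℝ) ≤ δ := by exact_mod_cast hδ
  have hg' : (0 : ℝ) ≤ g := Nat.cast_nonneg g
  have hxg : 0 < x ^ g := pow_pos hx g
  have hxd : 0 < x ^ δ := pow_pos hx δ
  have hp : 0 < γ + η * x ^ g := by positivity
  rw [pow_add] at hrx hD
  -- D · (γ + η x^g) = g x^g (βγ − αη) − δ (α + β x^g)(γ + η x^g) < 0
  have iden : (β * g * x ^ g - γ * δ * x ^ δ - η * (g + δ) * (x ^ g * x ^ δ)) * (γ + η * x ^ g)
      = g * x ^ g * (β * γ - α * η) - δ * (α + β * x ^ g) * (γ + η * x ^ g)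
        + (γ * δ + η * (g + δ) * x ^ g) * (α + β * x ^ g - γ * x ^ δ - η * (x ^ g * x ^ δ)) := by ring
  rw [hD, hrx, zero_mul, mul_zero, add_zero] at iden
  have h1 : g * x ^ g * (β * γ - α * η) ≤ 0 :=
    mul_nonpos_of_nonneg_of_nonpos (by positivity) (by linarith)
  have h2 : 0 < δ * (α + β * x ^ g) * (γ + η * x ^ g) := by
    have : 0 < α + β * x ^ g := by rw [show α + β * x ^ g = x ^ δ * (γ + η * x ^ g) by linarith]; positivity
    positivity
  linarith

/-- **The residual tetranomial has at most one positive root, counted with multiplicity.**  For reals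
`A, B > 0 > C₀, D` with `B·(−C₀) ≤ A·(−D)` and exponents `n₁ = n₀ + g`, `n₂ = n₀ + δ`, `n₃ = n₀ + g + δ` with `g, δ ≥ 1`:
`#Z₊^{mult}(A X^{n₀} + B X^{n₁} + C₀ X^{n₂} + D X^{n₃}) ≤ 1`. [folklore] -/
theorem countP_posRoots_tetranomial_le_one (A B C₀ D : ℝ) (hA : 0 < A) (hB : 0 < B) (hC : C₀ < 0) (hD : D < 0)
    (hmono : B * (-C₀) ≤ A * (-D)) {n₀ n₁ n₂ n₃ g δ : ℕ} (hg : 0 < g) (hδ : 0 < δ)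
    (h₁ : n₁ = n₀ + g) (h₂ : n₂ = n₀ + δ) (h₃ : n₃ = n₀ + g + δ) :
    (C A * X ^ n₀ + C B * X ^ n₁ + C C₀ * X ^ n₂ + C D * X ^ n₃ : ℝ[X]).roots.countP (fun x => 0 < x) ≤ 1 := by
  classical
  have _hB := hB
  subst h₁ h₂ h₃
  set Q : ℝ[X] := C A + C B * X ^ g + C C₀ * X ^ δ + C D * X ^ (g + δ) with hQ
  have hfac : (C A * X ^ n₀ + C B * X ^ (n₀ + g) + C C₀ * X ^ (n₀ + δ) + C D * X ^ (n₀ + g + δ) : ℝ[X])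
      = X ^ n₀ * Q := by rw [hQ]; ring
  rw [hfac, countP_posRoots_X_pow_mul]
  have hQ0 : Q ≠ 0 := by
    intro h
    have := congr_arg (fun p : ℝ[X] => p.coeff 0) h
    simp only [hQ, coeff_add, coeff_C_zero, coeff_C_mul, coeff_X_pow, coeff_zero] at this
    rw [if_neg (by omega), if_neg (by omega), if_neg (by omega)] at this
    linarith
  have hev : ∀ x : ℝ, Q.eval x = A + B * x ^ g - (-C₀) * x ^ δ - (-D) * x ^ (g + δ) := by
    intro x; simp only [hQ, eval_add, eval_mul, eval_C, eval_pow, eval_X]; ring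
  have hDer : X * derivative Q = C (B * g) * X ^ g + C (C₀ * δ) * X ^ δ + C (D * ((g : ℝ) + δ)) * X ^ (g + δ) := by
    have e1 := Literature.Analysis.FluidPDE.Elgindi.X_mul_derivative_X_pow g
    have e2 := Literature.Analysis.FluidPDE.Elgindi.X_mul_derivative_X_pow δ
    have e3 := Literature.Analysis.FluidPDE.Elgindi.X_mul_derivative_X_pow (g + δ)
    have hlin : X * derivative Q = C B * (X * derivative (X ^ g)) + C C₀ * (X * derivative (X ^ δ))
        + C D * (X * derivative (X ^ (g + δ))) := by
      simp only [hQ, derivative_add, derivative_C_mul, derivative_C, zero_add]; ring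
    rw [hlin, e1, e2, e3]
    simp only [map_mul, map_add, Nat.cast_add]; ring
  have hevD : ∀ x : ℝ, (X * derivative Q).eval x
      = B * g * x ^ g - (-C₀) * δ * x ^ δ - (-D) * (g + δ) * x ^ (g + δ) := by
    intro x; rw [hDer]; simp only [eval_add, eval_mul, eval_C, eval_pow, eval_X]; ring
  -- distinct positive roots: at most one
  set S := Q.roots.toFinset.filter (fun x => 0 < x) with hS
  have hmem : ∀ x ∈ S, 0 < x ∧ Q.eval x = 0 := by
    intro x hx
    rw [hS, Finset.mem_filter, Multiset.mem_toFinset, mem_roots hQ0] at hx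
    exact ⟨hx.2, hx.1⟩
  have hcard : S.card ≤ 1 := by
    refine Finset.card_le_one.mpr fun x hx y hy => ?_
    obtain ⟨hx0, hxr⟩ := hmem x hx
    obtain ⟨hy0, hyr⟩ := hmem y hy
    rw [hev] at hxr hyr
    rcases lt_trichotomy x y with hlt | heq | hgt
    · exact (tetranomial_no_two_posRoots (neg_pos.2 hC) (neg_pos.2 hD) hmono hδ hx0 hlt hxr hyr).elim
    · exact heq
    · exact (tetranomial_no_two_posRoots (neg_pos.2 hC) (neg_pos.2 hD) hmono hδ hy0 hgt hyr hxr).elim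
  -- every positive root is simple
  have hmult : ∀ x ∈ S, Q.rootMultiplicity x ≤ 1 := by
    intro x hx
    obtain ⟨hx0, hxr⟩ := hmem x hx
    by_contra hm
    rw [not_le] at hm
    have h1 := rootMultiplicity_sub_one_le_derivative_rootMultiplicity Q x
    have hdpos : 0 < (derivative Q).rootMultiplicity x := by omega
    have hdroot : (derivative Q).IsRoot x := ((rootMultiplicity_pos'.mp hdpos)).2
    have hzero : (X * derivative Q).eval x = 0 := by rw [eval_mul, eval_X, hdroot.eq_zero, mul_zero]
    rw [hevD] at hzero
    rw [hev] at hxr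
    exact tetranomial_euler_ne_zero (neg_pos.2 hC) (neg_pos.2 hD) hmono hδ hx0 hxr hzero
  rw [countP_posRoots_eq_sum_rootMultiplicity]
  calc ∑ x ∈ S, Q.rootMultiplicity x ≤ ∑ x ∈ S, 1 := Finset.sum_le_sum hmult
    _ = S.card := by simp
    _ ≤ 1 := hcard

/-! ### Chamber 1706, edge `6..17`: the chamber-uniform multiplier inequality and the capacity theorem -/

/-- **Multiplier inequality for `ZP(6..17)`, rows `(0,1)`, columns `{3,4}`, in the slack coordinates of chamber 1706**
(`p = d₂−d₁`, `q = 2d₁−d₂`, `r = d₃−2d₂`, `s = d₄−2d₃`, `v = d₅−2d₄+d₃`, all positive on the chamber).  With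
`P₀ = |M₀₃|`, `P₁ = |M₀₄|`, `P₂ = |M₁₃|`, `P₃ = |M₁₄|` (`M_ij = ∏_{e∈E}(d_i+d_j−e)`, `E` = the eight killed exponents
`d₅, d₁+d₅, d₂+d₃, d₂+d₄, d₂+d₅, 2d₃, d₃+d₄, 2d₄`) written as products of positive linear forms:
`P₁·P₂ ≤ P₀·P₃`, i.e. `ν₄ ≤ ν₃` (seat note W4-E1G20 §2: certified by three grouped sub-inequalities whose
differences have non-negative slack expansions). [folklore] -/
theorem twoRow_multiplier_ineq_6_17 (p q r s v : ℝ) (hp : 0 < p) (hq : 0 < q) (hr : 0 < r) (hs : 0 < s)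
    (hv : 0 < v) :
    ((4 * p + 2 * q + r + s + v) * (5 * p + 3 * q + r + s + v) * (2 * p + q + r + s) * (2 * p + q)
        * (6 * p + 3 * q + r + s + v) * s * (4 * p + 2 * q + r) * (8 * p + 4 * q + 2 * r + s))
      * ((7 * p + 3 * q + 2 * r + 2 * s + v) * (8 * p + 4 * q + 2 * r + 2 * s + v) * p * (5 * p + 2 * q + r + s)
        * (9 * p + 4 * q + 2 * r + 2 * s + v) * (3 * p + q + r) * (7 * p + 3 * q + 2 * r + s)
        * (11 * p + 5 * q + 3 * r + 2 * s))
    ≤ ((8 * p + 4 * q + 2 * r + 2 * s + v) * (9 * p + 5 * q + 2 * r + 2 * s + v) * (2 * p + q)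
        * (6 * p + 3 * q + r + s) * (10 * p + 5 * q + 2 * r + 2 * s + v) * (4 * p + 2 * q + r)
        * (8 * p + 4 * q + 2 * r + s) * (12 * p + 6 * q + 3 * r + 2 * s))
      * ((3 * p + q + r + s + v) * (4 * p + 2 * q + r + s + v) * (3 * p + 2 * q + r + s) * p
        * (5 * p + 2 * q + r + s + v) * (p + q + s) * (3 * p + q + r) * (7 * p + 3 * q + 2 * r + s)) := by
  -- the three grouped sub-inequalities (differences = polynomials with non-negative coefficients)
  have g1 : (5 * p + 2 * q + r + s) * (9 * p + 4 * q + 2 * r + 2 * s + v)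
      ≤ (9 * p + 5 * q + 2 * r + 2 * s + v) * (6 * p + 3 * q + r + s) := by
    have : (9 * p + 5 * q + 2 * r + 2 * s + v) * (6 * p + 3 * q + r + s)
        - (5 * p + 2 * q + r + s) * (9 * p + 4 * q + 2 * r + 2 * s + v)
        = q * v + 3 * q * s + 3 * q * r + 7 * q ^ 2 + p * v + 2 * p * s + 2 * p * r + 19 * p * q + 9 * p ^ 2 := by
      ring
    nlinarith [this, hp, hq, hr, hs, hv, mul_pos hp hq, mul_pos hq hv]
  have g2 : (6 * p + 3 * q + r + s + v) * (7 * p + 3 * q + 2 * r + 2 * s + v) * (11 * p + 5 * q + 3 * r + 2 * s)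
      ≤ (10 * p + 5 * q + 2 * r + 2 * s + v) * (12 * p + 6 * q + 3 * r + 2 * s) * (5 * p + 2 * q + r + s + v) := by
    have : (10 * p + 5 * q + 2 * r + 2 * s + v) * (12 * p + 6 * q + 3 * r + 2 * s) * (5 * p + 2 * q + r + s + v)
        - (6 * p + 3 * q + r + s + v) * (7 * p + 3 * q + 2 * r + 2 * s + v) * (11 * p + 5 * q + 3 * r + 2 * s)
        = q * v ^ 2 + 5 * q * s * v + 2 * q * s ^ 2 + 6 * q * r * v + 4 * q * r * s + 2 * q * r ^ 2
          + 12 * q ^ 2 * v + 11 * q ^ 2 * s + 12 * q ^ 2 * r + 15 * q ^ 3 + p * v ^ 2 + 7 * p * s * v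
          + 4 * p * s ^ 2 + 9 * p * r * v + 9 * p * r * s + 5 * p * r ^ 2 + 43 * p * q * v + 46 * p * q * s
          + 52 * p * q * r + 96 * p * q ^ 2 + 37 * p ^ 2 * v + 47 * p ^ 2 * s + 55 * p ^ 2 * r
          + 201 * p ^ 2 * q + 138 * p ^ 3 := by
      ring
    have hnn : 0 ≤ q * v ^ 2 + 5 * q * s * v + 2 * q * s ^ 2 + 6 * q * r * v + 4 * q * r * s + 2 * q * r ^ 2
          + 12 * q ^ 2 * v + 11 * q ^ 2 * s + 12 * q ^ 2 * r + 15 * q ^ 3 + p * v ^ 2 + 7 * p * s * v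
          + 4 * p * s ^ 2 + 9 * p * r * v + 9 * p * r * s + 5 * p * r ^ 2 + 43 * p * q * v + 46 * p * q * s
          + 52 * p * q * r + 96 * p * q ^ 2 + 37 * p ^ 2 * v + 47 * p ^ 2 * s + 55 * p ^ 2 * r
          + 201 * p ^ 2 * q + 138 * p ^ 3 := by positivity
    linarith
  have g3 : (5 * p + 3 * q + r + s + v) * (2 * p + q + r + s) * s
      ≤ (3 * p + q + r + s + v) * (3 * p + 2 * q + r + s) * (p + q + s) := by
    have : (3 * p + q + r + s + v) * (3 * p + 2 * q + r + s) * (p + q + s)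
        - (5 * p + 3 * q + r + s + v) * (2 * p + q + r + s) * s
        = 2 * q * s * v + q * r * v + q * r * s + q * r ^ 2 + 2 * q ^ 2 * v + 2 * q ^ 2 * s + 3 * q ^ 2 * r
          + 2 * q ^ 3 + 2 * p * s * v + p * r * v + p * r * s + p * r ^ 2 + 5 * p * q * v + 7 * p * q * s
          + 9 * p * q * r + 11 * p * q ^ 2 + 3 * p ^ 2 * v + 5 * p ^ 2 * s + 6 * p ^ 2 * r + 18 * p ^ 2 * q
          + 9 * p ^ 3 := by
      ring
    have hnn : 0 ≤ 2 * q * s * v + q * r * v + q * r * s + q * r ^ 2 + 2 * q ^ 2 * v + 2 * q ^ 2 * s + 3 * q ^ 2 * r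
          + 2 * q ^ 3 + 2 * p * s * v + p * r * v + p * r * s + p * r ^ 2 + 5 * p * q * v + 7 * p * q * s
          + 9 * p * q * r + 11 * p * q ^ 2 + 3 * p ^ 2 * v + 5 * p ^ 2 * s + 6 * p ^ 2 * r + 18 * p ^ 2 * q
          + 9 * p ^ 3 := by positivity
    linarith
  -- turn the linear forms into atoms, then regroup (cheap `ring` on atoms) and compare group by group
  have pf0 : 0 < 8 * p + 4 * q + 2 * r + 2 * s + v := by positivity
  have pf1 : 0 < 9 * p + 5 * q + 2 * r + 2 * s + v := by positivity
  have pf2 : 0 < 2 * p + q := by positivity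
  have pf3 : 0 < 6 * p + 3 * q + r + s := by positivity
  have pf4 : 0 < 10 * p + 5 * q + 2 * r + 2 * s + v := by positivity
  have pf5 : 0 < 4 * p + 2 * q + r := by positivity
  have pf6 : 0 < 8 * p + 4 * q + 2 * r + s := by positivity
  have pf7 : 0 < 12 * p + 6 * q + 3 * r + 2 * s := by positivity
  have pf8 : 0 < 4 * p + 2 * q + r + s + v := by positivity
  have pf9 : 0 < 5 * p + 3 * q + r + s + v := by positivity
  have pf10 : 0 < 2 * p + q + r + s := by positivity
  have pf11 : 0 < 6 * p + 3 * q + r + s + v := by positivity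
  have pf12 : 0 < 7 * p + 3 * q + 2 * r + 2 * s + v := by positivity
  have pf13 : 0 < 5 * p + 2 * q + r + s := by positivity
  have pf14 : 0 < 9 * p + 4 * q + 2 * r + 2 * s + v := by positivity
  have pf15 : 0 < 3 * p + q + r := by positivity
  have pf16 : 0 < 7 * p + 3 * q + 2 * r + s := by positivity
  have pf17 : 0 < 11 * p + 5 * q + 3 * r + 2 * s := by positivity
  have pf18 : 0 < 3 * p + q + r + s + v := by positivity
  have pf19 : 0 < 3 * p + 2 * q + r + s := by positivity
  have pf20 : 0 < 5 * p + 2 * q + r + s + v := by positivity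
  have pf21 : 0 < p + q + s := by positivity
  generalize hf4 : 10 * p + 5 * q + 2 * r + 2 * s + v = f4 at *
  generalize hf0 : 8 * p + 4 * q + 2 * r + 2 * s + v = f0 at *
  generalize hf1 : 9 * p + 5 * q + 2 * r + 2 * s + v = f1 at *
  generalize hf12 : 7 * p + 3 * q + 2 * r + 2 * s + v = f12 at *
  generalize hf14 : 9 * p + 4 * q + 2 * r + 2 * s + v = f14 at *
  generalize hf7 : 12 * p + 6 * q + 3 * r + 2 * s = f7 at *
  generalize hf17 : 11 * p + 5 * q + 3 * r + 2 * s = f17 at *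
  generalize hf6 : 8 * p + 4 * q + 2 * r + s = f6 at *
  generalize hf8 : 4 * p + 2 * q + r + s + v = f8 at *
  generalize hf9 : 5 * p + 3 * q + r + s + v = f9 at *
  generalize hf11 : 6 * p + 3 * q + r + s + v = f11 at *
  generalize hf16 : 7 * p + 3 * q + 2 * r + s = f16 at *
  generalize hf20 : 5 * p + 2 * q + r + s + v = f20 at *
  generalize hf3 : 6 * p + 3 * q + r + s = f3 at *
  generalize hf13 : 5 * p + 2 * q + r + s = f13 at *
  generalize hf18 : 3 * p + q + r + s + v = f18 at *
  generalize hf19 : 3 * p + 2 * q + r + s = f19 at *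
  generalize hf5 : 4 * p + 2 * q + r = f5 at *
  generalize hf10 : 2 * p + q + r + s = f10 at *
  generalize hf15 : 3 * p + q + r = f15 at *
  generalize hf2 : 2 * p + q = f2 at *
  generalize hf21 : p + q + s = f21 at *
  have eR : f8 * f9 * f10 * f2 * f11 * s * f5 * f6 * (f12 * f0 * p * f13 * f14 * f15 * f16 * f17)
      = (f0 * f2 * f5 * f6 * f8 * p * f15 * f16) * ((f13 * f14) * ((f11 * f12 * f17) * (f9 * f10 * s))) := by ring
  have eL : f0 * f1 * f2 * f3 * f4 * f5 * f6 * f7 * (f18 * f8 * f19 * p * f20 * f21 * f15 * f16)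
      = (f0 * f2 * f5 * f6 * f8 * p * f15 * f16) * ((f1 * f3) * ((f4 * f7 * f20) * (f18 * f19 * f21))) := by ring
  rw [eR, eL]
  gcongr

/-- **THEOREM O6, edge `6..17` (chamber-uniform two-row covariance kill).**  For EVERY exponent vector of chamber 1706
(`d₁ < d₂ < 2d₁`, `2d₂ < d₃`, `2d₃ < d₄`, `2d₄ − d₃ < d₅`; the upper facet is not needed) and all real coefficients with
the cell's signs on the four kept terms (`a₀c₃, a₀c₄ > 0 > a₁c₃, a₁c₄`; `a₂, c₅, b₃, b₄` arbitrary), the 12-term edge form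
`F = (a₀ + a₁X^{d₁} + a₂X^{d₂})(c₃X^{d₃} + c₄X^{d₄} + c₅X^{d₅}) − (b₃X^{d₃} + b₄X^{d₄})²` has at most `9 < 11 = #terms − 1`
positive roots COUNTED WITH MULTIPLICITY — so no hypothetical twenty on a chamber-1706 support degenerates through elbow 6
(hull-edge sharpness would need 11). [folklore] -/
theorem countP_posRoots_zp_6_17_le (d₁ d₂ d₃ d₄ d₅ : ℕ) (h₁ : d₁ < d₂) (h₂ : d₂ < 2 * d₁) (h₃ : 2 * d₂ < d₃)
    (h₄ : 2 * d₃ < d₄) (h₅ : 2 * d₄ < d₃ + d₅) (a₀ a₁ a₂ c₃ c₄ c₅ b₃ b₄ : ℝ) (s₀₃ : 0 < a₀ * c₃)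
    (s₀₄ : 0 < a₀ * c₄) (s₁₃ : a₁ * c₃ < 0) (s₁₄ : a₁ * c₄ < 0) :
    (((C a₀ + C a₁ * X ^ d₁ + C a₂ * X ^ d₂) * (C c₃ * X ^ d₃ + C c₄ * X ^ d₄ + C c₅ * X ^ d₅)
        - (C b₃ * X ^ d₃ + C b₄ * X ^ d₄) ^ 2 : ℝ[X]).roots.countP (fun x => 0 < x)) ≤ 9 := by
  classical
  -- exponents / coefficients of the twelve terms, kept rows `a₀,a₁` × columns `c₃,c₄` first
  set e : ℕ → ℕ := fun t => match t with
    | 0 => d₃ | 1 => d₄ | 2 => d₁ + d₃ | 3 => d₁ + d₄ | 4 => d₅ | 5 => d₁ + d₅ | 6 => d₂ + d₃ | 7 => d₂ + d₄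
    | 8 => d₂ + d₅ | 9 => 2 * d₃ | 10 => d₃ + d₄ | 11 => 2 * d₄ | _ => 0 with he
  set c : ℕ → ℝ := fun t => match t with
    | 0 => a₀ * c₃ | 1 => a₀ * c₄ | 2 => a₁ * c₃ | 3 => a₁ * c₄ | 4 => a₀ * c₅ | 5 => a₁ * c₅ | 6 => a₂ * c₃
    | 7 => a₂ * c₄ | 8 => a₂ * c₅ | 9 => -(b₃ ^ 2) | 10 => -(b₃ * b₄ + b₃ * b₄) | 11 => -(b₄ ^ 2) | _ => 0 with hc
  have hF : ((C a₀ + C a₁ * X ^ d₁ + C a₂ * X ^ d₂) * (C c₃ * X ^ d₃ + C c₄ * X ^ d₄ + C c₅ * X ^ d₅)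
        - (C b₃ * X ^ d₃ + C b₄ * X ^ d₄) ^ 2 : ℝ[X]) = ∑ t ∈ range 12, C (c t) * X ^ (e t) := by
    simp only [Finset.sum_range_succ, Finset.sum_range_zero, zero_add, he, hc, map_mul, map_neg,
      map_pow, map_add, pow_add, two_mul]
    ring
  rw [hF]
  have step := countP_posRoots_le_countP_twists 12 e c (Ico 4 12)
  have hcard : (Ico 4 12).card = 8 := by simp
  rw [hcard] at step
  -- the residual: the killed terms vanish, four terms survive
  obtain ⟨M, hM⟩ : ∃ M : ℕ → ℝ, ∀ t, M t = ∏ u ∈ Ico 4 12, ((e t : ℝ) - e u) := ⟨_, fun _ => rfl⟩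
  have hres : (∑ t ∈ range 12, C (c t * ∏ u ∈ Ico 4 12, ((e t : ℝ) - e u)) * X ^ (e t) : ℝ[X])
      = C (c 0 * M 0) * X ^ (e 0) + C (c 1 * M 1) * X ^ (e 1) + C (c 2 * M 2) * X ^ (e 2)
        + C (c 3 * M 3) * X ^ (e 3) := by
    rw [Finset.range_eq_Ico, ← Finset.sum_Ico_consecutive _ (show 0 ≤ 4 by norm_num) (show 4 ≤ 12 by norm_num)]
    have hz : (∑ t ∈ Ico 4 12, C (c t * ∏ u ∈ Ico 4 12, ((e t : ℝ) - e u)) * X ^ (e t) : ℝ[X]) = 0 := by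
      refine Finset.sum_eq_zero fun t ht => ?_
      rw [Finset.prod_eq_zero ht (sub_self _), mul_zero, map_zero, zero_mul]
    rw [hz, add_zero, Nat.Ico_zero_eq_range]
    simp only [Finset.sum_range_succ, Finset.sum_range_zero, zero_add, ← hM]
  rw [hres] at step
  -- exponents of the kept terms
  have e0 : e 0 = d₃ := rfl
  have e1 : e 1 = d₄ := rfl
  have e2 : e 2 = d₁ + d₃ := rfl
  have e3 : e 3 = d₁ + d₄ := rfl
  have c0 : c 0 = a₀ * c₃ := rfl
  have c1 : c 1 = a₀ * c₄ := rfl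
  have c2 : c 2 = a₁ * c₃ := rfl
  have c3 : c 3 = a₁ * c₄ := rfl
  rw [e0, e1, e2, e3, c0, c1, c2, c3] at step
  -- slack coordinates of the chamber (reals)
  have r₁ : (d₁ : ℝ) < d₂ := by exact_mod_cast h₁
  have r₂ : (d₂ : ℝ) < 2 * d₁ := by exact_mod_cast h₂
  have r₃ : 2 * (d₂ : ℝ) < d₃ := by exact_mod_cast h₃
  have r₄ : 2 * (d₃ : ℝ) < d₄ := by exact_mod_cast h₄
  have r₅ : 2 * (d₄ : ℝ) < d₃ + d₅ := by exact_mod_cast h₅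
  set p : ℝ := (d₂ : ℝ) - d₁ with hp
  set q : ℝ := 2 * (d₁ : ℝ) - d₂ with hq
  set r : ℝ := (d₃ : ℝ) - 2 * d₂ with hr
  set s : ℝ := (d₄ : ℝ) - 2 * d₃ with hs
  set v : ℝ := (d₅ : ℝ) - 2 * d₄ + d₃ with hv
  have pp : 0 < p := by rw [hp]; linarith
  have qp : 0 < q := by rw [hq]; linarith
  have rp : 0 < r := by rw [hr]; linarith
  have sp : 0 < s := by rw [hs]; linarith
  have vp : 0 < v := by rw [hv]; linarith
  -- the four multipliers as products of positive linear forms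
  have unroll : ∀ t, M t = ((e t : ℝ) - e 4) * ((e t : ℝ) - e 5) * ((e t : ℝ) - e 6) * ((e t : ℝ) - e 7)
      * ((e t : ℝ) - e 8) * ((e t : ℝ) - e 9) * ((e t : ℝ) - e 10) * ((e t : ℝ) - e 11) := by
    intro t
    rw [hM, Finset.prod_Ico_eq_prod_range]
    simp only [show (12 : ℕ) - 4 = 8 by norm_num, Finset.prod_range_succ, Finset.prod_range_zero, one_mul,
      Nat.reduceAdd]
  have e4 : e 4 = d₅ := rfl
  have e5 : e 5 = d₁ + d₅ := rfl
  have e6 : e 6 = d₂ + d₃ := rfl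
  have e7 : e 7 = d₂ + d₄ := rfl
  have e8 : e 8 = d₂ + d₅ := rfl
  have e9 : e 9 = 2 * d₃ := rfl
  have e10 : e 10 = d₃ + d₄ := rfl
  have e11 : e 11 = 2 * d₄ := rfl
  have hM0 : M 0 = (8 * p + 4 * q + 2 * r + 2 * s + v) * (9 * p + 5 * q + 2 * r + 2 * s + v) * (2 * p + q)
      * (6 * p + 3 * q + r + s) * (10 * p + 5 * q + 2 * r + 2 * s + v) * (4 * p + 2 * q + r)
      * (8 * p + 4 * q + 2 * r + s) * (12 * p + 6 * q + 3 * r + 2 * s) := by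
    rw [unroll, e0, e4, e5, e6, e7, e8, e9, e10, e11, hp, hq, hr, hs, hv]; push_cast; ring
  have hM1 : M 1 = (4 * p + 2 * q + r + s + v) * (5 * p + 3 * q + r + s + v) * (2 * p + q + r + s) * (2 * p + q)
      * (6 * p + 3 * q + r + s + v) * s * (4 * p + 2 * q + r) * (8 * p + 4 * q + 2 * r + s) := by
    rw [unroll, e1, e4, e5, e6, e7, e8, e9, e10, e11, hp, hq, hr, hs, hv]; push_cast; ring
  have hM2 : M 2 = (7 * p + 3 * q + 2 * r + 2 * s + v) * (8 * p + 4 * q + 2 * r + 2 * s + v) * p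
      * (5 * p + 2 * q + r + s) * (9 * p + 4 * q + 2 * r + 2 * s + v) * (3 * p + q + r)
      * (7 * p + 3 * q + 2 * r + s) * (11 * p + 5 * q + 3 * r + 2 * s) := by
    rw [unroll, e2, e4, e5, e6, e7, e8, e9, e10, e11, hp, hq, hr, hs, hv]; push_cast; ring
  have hM3 : M 3 = (3 * p + q + r + s + v) * (4 * p + 2 * q + r + s + v) * (3 * p + 2 * q + r + s) * p
      * (5 * p + 2 * q + r + s + v) * (p + q + s) * (3 * p + q + r) * (7 * p + 3 * q + 2 * r + s) := by
    rw [unroll, e3, e4, e5, e6, e7, e8, e9, e10, e11, hp, hq, hr, hs, hv]; push_cast; ring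
  have M0p : 0 < M 0 := by rw [hM0]; positivity
  have M1p : 0 < M 1 := by rw [hM1]; positivity
  have M2p : 0 < M 2 := by rw [hM2]; positivity
  have M3p : 0 < M 3 := by rw [hM3]; positivity
  have K2 : M 1 * M 2 ≤ M 0 * M 3 := by
    rw [hM0, hM1, hM2, hM3]; exact twoRow_multiplier_ineq_6_17 p q r s v pp qp rp sp vp
  -- the residual tetranomial has at most one positive root
  have hA : 0 < a₀ * c₃ * M 0 := mul_pos s₀₃ M0p
  have hB : 0 < a₀ * c₄ * M 1 := mul_pos s₀₄ M1p
  have hC : a₁ * c₃ * M 2 < 0 := mul_neg_of_neg_of_pos s₁₃ M2p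
  have hD : a₁ * c₄ * M 3 < 0 := mul_neg_of_neg_of_pos s₁₄ M3p
  have hmono : a₀ * c₄ * M 1 * -(a₁ * c₃ * M 2) ≤ a₀ * c₃ * M 0 * -(a₁ * c₄ * M 3) := by
    have iden : a₀ * c₃ * M 0 * -(a₁ * c₄ * M 3) - a₀ * c₄ * M 1 * -(a₁ * c₃ * M 2)
        = (a₀ * c₄ * -(a₁ * c₃)) * (M 0 * M 3 - M 1 * M 2) := by ring
    have hk : 0 ≤ a₀ * c₄ * -(a₁ * c₃) := mul_nonneg s₀₄.le (neg_nonneg.2 s₁₃.le)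
    rw [← sub_nonneg, iden]
    exact mul_nonneg hk (sub_nonneg.2 K2)
  have tet : ((C (a₀ * c₃ * M 0) * X ^ d₃ + C (a₀ * c₄ * M 1) * X ^ d₄ + C (a₁ * c₃ * M 2) * X ^ (d₁ + d₃)
      + C (a₁ * c₄ * M 3) * X ^ (d₁ + d₄) : ℝ[X]).roots.countP (fun x => 0 < x)) ≤ 1 :=
    countP_posRoots_tetranomial_le_one _ _ _ _ hA hB hC hD hmono (g := d₄ - d₃) (δ := d₁)
      (by omega) (by omega) (by omega) (by omega) (by omega)
  omega

end Summit.ValiantsHypothesis.ValiantsHypothesis.Theorems.LacunarySymmetroidMatrixDescartes.Census
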